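import Summits.Ventures.QEC.Census.CertBZList
import Summits.Ventures.QEC.Census.BB.A1s_n192_k4_0fa3ae82.L1Iface
import HarnessLib

set_option Elab.async false

/-!
# `[[192,4,18]]` one-level cover certificate — LEVEL-1 objects: decided structure facts (`L1Rows`; qec-search-9 g5, lead block 149 (1))

On the objects of `L1Iface`: the rows of both systematic matrices are words below `2^96` and there are 48 of them (hypotheses of the
`CertBZPlaneTree` leaves), the structural verdict `blockStructOK 96 17 eGb eBlock` (both matrices systematic on their information sets,
`|Aᵢ| = |eGb| = 48`, recounted Brouwer–Zimmermann bound `(8+1)+(7+1) = 17`), every word of the orbit list `eOrb` is below `2^96`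
(hypothesis `hallow` of `CertBZList.mem_allow_of_struct_reaches`), and the ROUND TRIP of the kernel-generated orbit table
(`orbCheck ePermqs eTr eInv 48 eReps`: every translate is carried back to its representative by the tabulated inverse permutation —
qec-type-10 `CertCoverBatch.witnessOK_of_orbCheck` turns it into the tree's `witnessOK`). Theorems only; `decide +kernel`; KERNEL.
-/

namespace Summit.Ventures.QEC.Census.A1s_n192_k4_0fa3ae82

open Summit.Ventures.QEC.Census

/-- Rows of level-1 matrix 0 are words below `2^96`. -/
theorem eG0_lt : ∀ g ∈ giRows eGb eM0, g < 2 ^ 96 := by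
  have h : ((giRows eGb eM0).all fun g => decide (g < 2 ^ 96)) = true := by decide +kernel
  simpa [List.all_eq_true] using h

/-- Rows of level-1 matrix 1 are words below `2^96`. -/
theorem eG1_lt : ∀ g ∈ giRows eGb eM1, g < 2 ^ 96 := by
  have h : ((giRows eGb eM1).all fun g => decide (g < 2 ^ 96)) = true := by decide +kernel
  simpa [List.all_eq_true] using h

/-- Matrix 0 has 48 rows. -/
theorem eG0_len : (giRows eGb eM0).length = 48 := by decide +kernel

/-- Matrix 1 has 48 rows. -/
theorem eG1_len : (giRows eGb eM1).length = 48 := by decide +kernel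

/-- STRUCTURE of the level-1 block (type-10 `blockStructOK`): both matrices systematic on `T₀` / `T₁` with rows below `2^96`,
`|Aᵢ| = 48`, and the recounted bound reaches `17`. -/
theorem eBlock_struct : blockStructOK 96 17 eGb eBlock = true := by decide +kernel

set_option maxHeartbeats 400000000 in
/-- Every word of the orbit list is below `2^96` (one kernel pass over `eOrb`). -/
theorem eOrb_lt : ∀ w ∈ eOrb, w < 2 ^ 96 := by
  have h : (eOrb.all fun w => decide (w < 2 ^ 96)) = true := by decide +kernel
  simpa [List.all_eq_true] using h

end Summit.Ventures.QEC.Census.A1s_n192_k4_0fa3ae82
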